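import Mathlib
import HarnessLib

/-!
# [OURS · L1 W4.5(b) · EL♮(3) · door ν4, D7 brick HNODE, core P6] SATURATION ALGEBRA FOR THE NOSE'S STRICT TRANSFORM

res-L1-w45b-stub-2 g17 (HNODE pen). `--supports stmt-ResolutionOfSingularities-20148 --as helper`, no claim, counted 0. OURS; NOT a statement of
[Hironaka2017]; AI-written, weaker than expert review. EL♮(3) is NOT proved here; char-p resolution is NOT proved anywhere in this tree. DEF-FREE.

Ring lemmas for P6 (`hTrace` of `Equinodal.hnode_rPlus_of_trace`): the stalk of the strict transform of the nose model `𝓦` (stalk `(e, g)`, `e` the host's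
equation, `g` the node's) through the section blow-up is the `t`-SATURATION of `(t e′, t² g′)` (`t` the exceptional equation, `e = t e′`, `g = t² g′` in
the chart), and that saturation is `(e′, g′)` as soon as `(e′)` is `t`-saturated and `g′` is a nonzerodivisor modulo `(e′, t)`:
* `mem_span_pair_of_mul_mem` — the two-generator saturation step;
* `iSup_colon_span_singleton_pow_eq` — `⋃ₙ ((t e′, t² g′) : tⁿ) = (e′, g′)` under those hypotheses;
* `mul_mem_span_pair_imp_of_isDomain_quotient` — `g′` is a nonzerodivisor modulo `(e′, t)` when `R ⧸ (e′, t)` is a domain in which `g′ ≠ 0`.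
-/

set_option linter.dupNamespace false

noncomputable section

namespace Summit.ResolutionOfSingularities.ResolutionOfSingularities.Cruxes.EquisingularLiftNat.Sections.Equinodal

namespace NoseTrace

universe u

variable {R : Type u} [CommRing R]

/-- **Two-generator saturation step.**  If `(e′)` is `t`-saturated and `g′` is a nonzerodivisor modulo `(e′, t)`, then `(e′, g′)` is `t`-saturated:
`t z ∈ (e′, g′) ⇒ z ∈ (e′, g′)`. [folklore] -/
theorem mem_span_pair_of_mul_mem (t e' g' : R) (h1 : ∀ z : R, t * z ∈ Ideal.span {e'} → z ∈ Ideal.span {e'})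
    (h2 : ∀ a : R, g' * a ∈ Ideal.span {e', t} → a ∈ Ideal.span {e', t}) (z : R) (hz : t * z ∈ Ideal.span {e', g'}) :
    z ∈ Ideal.span {e', g'} := by
  obtain ⟨a, b, hab⟩ := Ideal.mem_span_pair.mp hz
  -- modulo `(e′, t)`: `b g′ ≡ 0`, so `b ∈ (e′, t)`
  have hb : g' * b ∈ Ideal.span {e', t} := by
    have : g' * b = t * z - a * e' := by rw [← hab]; ring
    rw [this]
    exact Ideal.sub_mem _ (Ideal.mul_mem_right _ _ (Ideal.subset_span (by simp))) (Ideal.mul_mem_left _ _ (Ideal.subset_span (by simp)))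
  obtain ⟨c, d, hcd⟩ := Ideal.mem_span_pair.mp (h2 b hb)
  -- `t (z − d g′) = (a + c g′) e′`
  have hte : t * (z - d * g') ∈ Ideal.span {e'} := by
    have : t * (z - d * g') = (a + c * g') * e' := by
      have h := hab; rw [← hcd] at h; linear_combination -h
    rw [this]; exact Ideal.mul_mem_left _ _ (Ideal.mem_span_singleton_self e')
  have hz' := h1 _ hte
  obtain ⟨r, hr⟩ := Ideal.mem_span_singleton'.mp hz'
  have : z = r * e' + d * g' := by linear_combination -hr
  rw [this]
  exact Ideal.add_mem _ (Ideal.mul_mem_left _ _ (Ideal.subset_span (by simp))) (Ideal.mul_mem_left _ _ (Ideal.subset_span (by simp)))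

/-- Iterating: `(e′, g′)` is `tⁿ`-saturated for every `n`. [folklore] -/
theorem mem_span_pair_of_pow_mul_mem (t e' g' : R) (h1 : ∀ z : R, t * z ∈ Ideal.span {e'} → z ∈ Ideal.span {e'})
    (h2 : ∀ a : R, g' * a ∈ Ideal.span {e', t} → a ∈ Ideal.span {e', t}) (n : ℕ) (z : R) (hz : t ^ n * z ∈ Ideal.span {e', g'}) :
    z ∈ Ideal.span {e', g'} := by
  induction n generalizing z with
  | zero => simpa using hz
  | succ n ih =>
    apply ih
    apply mem_span_pair_of_mul_mem t e' g' h1 h2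
    rw [← mul_assoc, ← pow_succ']; exact hz

/-- **`⋃ₙ ((t e′, t² g′) : tⁿ) = (e′, g′)`** when `(e′)` is `t`-saturated and `g′` is a nonzerodivisor modulo `(e′, t)` — the stalk of the strict transform
of the nose model in the chart (via `stalkIdeal_strictTransformIdeal`). [folklore] -/
theorem iSup_colon_span_singleton_pow_eq (t e' g' : R) (h1 : ∀ z : R, t * z ∈ Ideal.span {e'} → z ∈ Ideal.span {e'})
    (h2 : ∀ a : R, g' * a ∈ Ideal.span {e', t} → a ∈ Ideal.span {e', t})
    (I : Ideal R) (hI : I = Ideal.span {t * e', t ^ 2 * g'}) :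
    (⨆ n : ℕ, Submodule.colon I ((Ideal.span {t} ^ n : Ideal R) : Set R)) = Ideal.span {e', g'} := by
  subst hI
  have hIle : Ideal.span {t * e', t ^ 2 * g'} ≤ Ideal.span {e', g'} := by
    rw [Ideal.span_le]
    intro y hy
    rcases hy with rfl | hy
    · exact Ideal.mul_mem_left _ _ (Ideal.subset_span (by simp))
    · rw [Set.mem_singleton_iff] at hy; subst hy; exact Ideal.mul_mem_left _ _ (Ideal.subset_span (by simp))
  apply le_antisymm
  · refine iSup_le fun n => ?_
    intro z hz
    rw [Submodule.mem_colon] at hz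
    have htn : t ^ n ∈ ((Ideal.span {t} ^ n : Ideal R) : Set R) := by
      rw [Ideal.span_singleton_pow]; exact Ideal.mem_span_singleton_self _
    have h := hz (t ^ n) htn
    have h' : t ^ n * z ∈ Ideal.span {t * e', t ^ 2 * g'} := by rwa [smul_eq_mul, mul_comm z (t ^ n)] at h
    exact mem_span_pair_of_pow_mul_mem t e' g' h1 h2 n z (hIle h')
  · rw [Ideal.span_le]
    intro y hy
    rcases hy with rfl | hy
    · -- `e′ ∈ (I : t)`
      refine Submodule.mem_iSup_of_mem 1 ?_
      rw [Submodule.mem_colon]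
      intro s hs
      rw [pow_one] at hs
      obtain ⟨r, rfl⟩ := Ideal.mem_span_singleton'.mp hs
      rw [smul_eq_mul, show y * (r * t) = r * (t * y) by ring]
      exact Ideal.mul_mem_left _ _ (Ideal.subset_span (by simp))
    · rw [Set.mem_singleton_iff] at hy; subst hy
      refine Submodule.mem_iSup_of_mem 2 ?_
      rw [Submodule.mem_colon]
      intro s hs
      rw [Ideal.span_singleton_pow] at hs
      obtain ⟨r, rfl⟩ := Ideal.mem_span_singleton'.mp hs
      rw [smul_eq_mul, show y * (r * t ^ 2) = r * (t ^ 2 * y) by ring]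
      exact Ideal.mul_mem_left _ _ (Ideal.subset_span (by simp))

/-- `g′` is a nonzerodivisor modulo `(e′, t)` when `R ⧸ (e′, t)` is a domain in which `g′ ≠ 0`. [folklore] -/
theorem mul_mem_span_pair_imp_of_isDomain_quotient (t e' g' : R) [IsDomain (R ⧸ Ideal.span {e', t})]
    (hg : Ideal.Quotient.mk (Ideal.span {e', t}) g' ≠ 0) (a : R) (ha : g' * a ∈ Ideal.span {e', t}) : a ∈ Ideal.span {e', t} := by
  rw [← Ideal.Quotient.eq_zero_iff_mem] at ha ⊢
  rw [map_mul] at ha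
  exact (mul_eq_zero.mp ha).resolve_left hg

end NoseTrace

end Summit.ResolutionOfSingularities.ResolutionOfSingularities.Cruxes.EquisingularLiftNat.Sections.Equinodal

end
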